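import Literature.RingTheory.KTheory.KZeroLocalRing
import Literature.LinearAlgebra.Matrix.SpecialLinearReductionSurjective
import Mathlib.LinearAlgebra.Projection
import Mathlib.Data.ZMod.Basic
import Mathlib.RingTheory.LocalRing.Basic
import Mathlib.Tactic.NoncommRing
import HarnessLib

/-!
# Goresky–Tai's Lemma 26: an integer matrix `A ≡ I (mod 2)` with `A² ≡ I (mod 2^{k+1})` is `GL_n(ℤ)`-conjugate
# to `diag(±1, …, ±1)` modulo `2^k` — via idempotent matrices over the local ring `ℤ/2^{k−1}ℤ`

Topic `Literature/LinearAlgebra/Matrix`, namespace `Literature.LinearAlgebra.Matrix`.  Lane `lit-hodgefound`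
(Track 2 foundations library), prover seat p15 generation 54, rows g54-#1 (§§0–5) and g54-#2 (§§6–7): the algebraic lemma of §10 («The principal
congruence group `Γ(2^k)`») of Goresky–Tai's paper on real points of Siegel moduli space, whose §§3–7 the seat's
lineage vendored under `Literature/AlgebraicGeometry/ModuliOfAbelianVarieties/SiegelFamilyReal*`.  It is used there
(Lemma 27, Theorem 28) to put the linear part `u = (A 0; 0 ᵗA⁻¹) ∈ ker ν` of a real boundary pair into the normal
form `diag(I_r, −I_s, I_r, −I_s) mod 2^k`.  THEOREMS ONLY: no definition, no instance, no notation, no named fact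
(net Literature debt `0`), no `sorry`.  Builds on the tree's `SL_n(ℤ) → SL_n(ℤ/Nℤ)` surjectivity
(`SpecialLinearReductionSurjective`, Andrianov–Zhuravlev Chap. 3 Lemma 3.2 (1)) and on «finitely generated projectives
over a local ring are free» for the image of an idempotent matrix (`RingTheory/KTheory/KZeroLocalRing`, Milnor §1
Lemma 1.2).

## Source, VERBATIM

M. Goresky, Y. S. Tai, *The moduli space of real abelian varieties with level structure*, Compositio Math. **139**
(2003) = arXiv:math/0108103, held `paper:arxiv-math_0108103`, §10.1 (p0017): «Throughout this section we let
`Γ = Γ(2^k) ⊂ Sp(2n, ℤ)` be the principal congruence subgroup of level `2^k` with `k ≥ 2`. […] **Lemma 26.** Let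
`A ∈ GL(n, ℤ)`.  Suppose that `A ≡ I mod 2` and `A² ≡ I mod 2^{k+1}`.  Then there exists `p ∈ GL(n, ℤ)` so that
`p⁻¹Ap ≡ diag(±1, ±1, ⋯, ±1) mod 2^k`.  Moreover if the matrix of `A` with respect to the standard basis of `ℤⁿ`
is `(I_q 0; * *)` then it is possible to choose `p` to be of the form `p = (I_q 0; * *)`.»  §10.4 (p0018–p0019),
proof: «The lemma is equivalent to the following statement.  Suppose `M` is a free `ℤ`-module of rank `n`.  Let
`α : M → M` be an automorphism such that `(α − I)M ⊂ 2M` and `(α² − I)M ⊂ 2^{k+1}M`, that is, `α ≡ I mod 2` and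
`α² ≡ I mod 2^{k+1}`.  Then there exists a basis `x_1, x_2, …, x_n` of `M` so that `α(x_i) = ±x_i ∈ 2^k M` for
`i = 1, 2, …, n`.  This statement will be proven by induction on the rank of `M`. […] By elementary divisor theory
there exists a basis `x_1, …, x_n` of `M` and integers `d_1 | d_2 | … | d_n` so that `d_1x_1, …, d_nx_n` is a basis
of `(α − I)M`. […] However, `(α − I)M + (α + I)M = 2M` so the highest power of `2` which divides `gcd(d_1, e_1)` is
`2¹`. […] Define a new basis `x′_j = x_j` if `ε_j = ε_1`, `ε_j x_j + ½a_j x_1` if `ε_j = −ε_1`. […] To prove the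
“moreover” part of the lemma, let `M′ = Σ_{i=1}^q ℤe_i` be the submodule of `M` generated by the first `q` standard
basis vectors.  Apply the lemma to the quotient module `α : M/M′ → M/M′`. […] Then `α(x′_i) ≡ ε_i x′_i mod 2^k` and
the change of basis matrix has the desired form.»  Use (§10.2, proof of Lemma 27, p0018): «Then
`γ̃′γ′ = au²a⁻¹ ∈ Γ(2^{k+1})` by Lemma 9, hence `A² ≡ I mod 2^{k+1}`.  Moreover, `A ∈ Γ(2)` and `A = (I_q 0; * *)`.
Let `p ∈ GL(n, ℤ)` be the change of basis provided by Lemma 26.»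

## The road taken (a deviation from the printed induction, announced)

The printed proof is an induction on the rank through the elementary divisors of `(α ∓ I)M`.  This file proves the
same statement by a shorter road through Mathlib and the tree, recorded here so that a reader can compare:
with `E = (A + I)/2` (integral because `A ≡ I (2)`) one has `4(E² − E) = A² − I`, so `A² ≡ I (2^{k+1})` says
exactly that `Ē = E mod 2^{k−1}` is an IDEMPOTENT of `M_n(ℤ/2^{k−1}ℤ)`; `ℤ/2^{k−1}ℤ` is a local ring, so
`(ℤ/2^{k−1})ⁿ = im Ē ⊕ ker Ē` with both summands free (direct summands of a free module over a local ring), and a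
basis adapted to the decomposition is a base change `P̄` of determinant `1` with `ĒP̄ = P̄·diag(d)`, `d ∈ {0,1}ⁿ`;
`P̄` lifts to `P ∈ SL_n(ℤ)`, and doubling the modulus, `AP = (2E − I)P ≡ P·diag(2d − 1) (mod 2^k)`.  The «moreover»
clause is the relative version: for the idempotent `(1 Ē₁₂; 0 Ē₂₂)` (so `Ē₁₂Ē₂₂ = 0`) the base change
`(1 −Ē₁₂Ȳ; 0 Ȳ)` works, and lifts to `(1 X; 0 Y)`, `Y ∈ SL(ℤ)`, keeping the identity columns exactly.  The
eigenvalue pattern `diag(±1, …, ±1)` is indexed by an arbitrary `ε : n → {±1}` (GT's display orders the signs;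
reordering is a permutation matrix and is not asserted).  The statements hold for every `k ≥ 0` (for `k ≤ 1` they
follow from `A ≡ I (2)` alone) and for every square integer matrix (`A ∈ GL(n, ℤ)` is not used), over any finite
index type; the conjugator is produced in `SL_n(ℤ) ⊆ GL(n, ℤ)`.

## What is proved

(Private plumbing, tagged `[folklore]`: `isLocalRing_zmod_prime_pow` (`ℤ/p^{j+1}ℤ` is local), the column
rescaling `exists_det_eq_one_mul_eq_mul_diagonal`, the reduction lemmas `map_intCast_zmod_eq_map_iff_forall_modEq`,
`map_intCast_zmod_eq_zero_iff_forall_dvd`, `diagonal_map_intCast_zmod`, `coe_specialLinearGroup_map_intCast`,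
`exists_natCast_smul_eq_of_map_intCast_zmod_eq_zero`, `inv_mul_mul_map_eq_of_mul_map_eq`, `det_fromBlocks_one_zero`.)
* §1 over a local ring `R`: **`exists_det_eq_one_mul_eq_mul_diagonal_of_isIdempotentElem`** (`E² = E` ⟹ `EP = P·diag(d)`, `det P = 1`,
  `d ∈ {0,1}ⁿ`), **`exists_fromBlocks_mul_eq_mul_diagonal_of_isIdempotentElem`** (relative version for
  `(1 E₁₂; 0 E₂₂)`).
* §2 **`exists_specialLinearGroup_map_eq_and_mul_map_eq`** (lift of a determinant-one diagonaliser to `SL_n(ℤ)`),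
  **`exists_fromBlocks_map_intCast_eq`** (relative lift `(1 X; 0 Y)`).
* §3 `exists_two_smul_eq_add_one` (`2E = A + I`),
  `four_smul_mul_sub_eq_of_two_smul_eq` (`4(E² − E) = A² − I`), **`isIdempotentElem_map_of_two_smul_eq`**,
  `mul_map_eq_mul_diagonal_map_of_two_smul_eq` (back from `E` to `A`, doubling the modulus),
  `mul_one_map_eq_of_le_one` (levels `k ≤ 1`), **`exists_specialLinearGroup_mul_map_eq_mul_diagonal`** (LEMMA 26:
  `AP ≡ P·diag(ε) (mod 2^k)`, `P ∈ SL_n(ℤ)`, `ε ∈ {±1}ⁿ`),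
  **`exists_specialLinearGroup_conj_modEq_diagonal`** (as printed: `P⁻¹AP ≡ diag(ε) mod 2^k`, entrywise).
* §4 **`exists_fromBlocks_mul_map_eq_mul_diagonal`** (the «moreover» clause in the
  column convention `A = (1 A₁₂; 0 A₂₂)`, `P = (1 X; 0 Y)`, `Y ∈ SL(ℤ)`).
* §5 **`exists_specialLinearGroup_fromBlocks_conj_map_eq_diagonal`** (the «moreover» clause as printed, row
  convention: `A = (1 0; A₂₁ A₂₂)` ⟹ `p = (1 0; p₂₁ p₂₂) ∈ SL(ℤ)` with `p⁻¹Ap ≡ diag(1, ε) (mod 2^k)`).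
* §6 **`exists_specialLinearGroup_conj_map_eq_diagonal_of_forall_mem_finset`** (the same over any finite index
  type, the identity rows being indexed by a finset `S`; `ε = 1` on `S`) — by reindexing along `S ⊕ Sᶜ ≃ n`.
* §7 **`exists_basis_forall_exists_apply_sub_smul_eq_pow_smul`** (the printed module form: an endomorphism `α`
  of a finitely generated free `ℤ`-module with `(α − 1)M ⊆ 2M`, `(α² − 1)M ⊆ 2^{k+1}M` has a basis `x_i` with
  `α(x_i) − ε_i x_i ∈ 2^k M`, `ε_i = ±1`).

## References

* [GoreskyTai2003RealModuli] M. Goresky, Y. S. Tai, The moduli space of real abelian varieties with level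
  structure, Compositio Math. 139 (2003), §10.1 Lemma 26, §10.4 (proof), §10.2 (use in Lemma 27);
  arXiv:math/0108103 p0017–p0019.
* [AndrianovZhuravlev2015] A. N. Andrianov, V. G. Zhuravlev, Modular Forms and Hecke Operators, Chap. 3 Lemma 3.2 (1)
  (tree: `Literature/LinearAlgebra/Matrix/SpecialLinearReductionSurjective`).
* [Milnor1972] J. Milnor, Introduction to Algebraic K-Theory, §1 Lemma 1.2 (tree:
  `Literature/RingTheory/KTheory/KZeroLocalRing`, `free_range_toLin'_of_isLocalRing`).
-/

open Matrix

namespace Literature.LinearAlgebra.Matrix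

/-! ## §0. `ℤ/p^{j+1}ℤ` is a local ring -/

/-- `ℤ/p^{j+1}ℤ` (`p` prime) is a local ring: an element is a unit or its complement to `1` is.  [folklore] -/
private theorem isLocalRing_zmod_prime_pow (p j : ℕ) [hp : Fact p.Prime] : IsLocalRing (ZMod (p ^ (j + 1))) := by
  haveI : Fact (1 < p ^ (j + 1)) := ⟨Nat.one_lt_pow (Nat.succ_ne_zero j) hp.out.one_lt⟩
  refine IsLocalRing.of_isUnit_or_isUnit_one_sub_self fun a => ?_
  by_cases h : p ∣ a.val
  · right
    have hle : a.val ≤ p ^ (j + 1) + 1 := (ZMod.val_lt a).le.trans (Nat.le_succ _)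
    have hrepr : (1 - a : ZMod (p ^ (j + 1))) = ((p ^ (j + 1) + 1 - a.val : ℕ) : ZMod (p ^ (j + 1))) := by
      rw [Nat.cast_sub hle, Nat.cast_add, ZMod.natCast_self, zero_add, Nat.cast_one, ZMod.natCast_zmod_val]
    rw [hrepr, ZMod.isUnit_iff_coprime]
    refine Nat.Coprime.pow_right _ ?_
    rw [Nat.coprime_comm, Nat.Prime.coprime_iff_not_dvd hp.out]
    intro hd
    have h1 : p ∣ p ^ (j + 1) := dvd_pow_self p (Nat.succ_ne_zero j)
    have h2 : p ∣ p ^ (j + 1) + 1 := by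
      have := dvd_add hd h
      rwa [Nat.sub_add_cancel hle] at this
    have h3 : p ∣ 1 := (Nat.dvd_add_right h1).1 h2
    exact hp.out.one_lt.ne' (Nat.dvd_one.1 h3)
  · left
    rw [← ZMod.natCast_zmod_val a, ZMod.isUnit_iff_coprime]
    exact Nat.Coprime.pow_right _ ((Nat.Prime.coprime_iff_not_dvd hp.out).2 h).symm

/-! ## §1. Idempotent matrices over a local ring are diagonalised by a determinant-one base change -/

section LocalRing

variable {R : Type*} [CommRing R] {n : Type*} [Fintype n] [DecidableEq n]

/-- Rescaling one column: a base change `P` of unit determinant with `EP = P·diag(d)` may be replaced by one of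
determinant `1`.  [folklore] -/
private theorem exists_det_eq_one_mul_eq_mul_diagonal {E P : Matrix n n R} {d : n → R} (hP : IsUnit P.det)
    (h : E * P = P * diagonal d) : ∃ P' : Matrix n n R, P'.det = 1 ∧ E * P' = P' * diagonal d := by
  obtain ⟨u, hu⟩ := hP
  rcases isEmpty_or_nonempty n with hn | ⟨⟨j₀⟩⟩
  · exact ⟨P, Matrix.det_isEmpty, h⟩
  · refine ⟨P * diagonal (Function.update (fun _ => (1 : R)) j₀ ↑u⁻¹), ?_, ?_⟩
    · rw [det_mul, det_diagonal, Finset.prod_update_of_mem (Finset.mem_univ j₀), Finset.prod_const_one, mul_one,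
        ← hu, Units.mul_inv]
    · rw [← Matrix.mul_assoc, h, Matrix.mul_assoc, Matrix.mul_assoc, diagonal_mul_diagonal, diagonal_mul_diagonal]
      congr 2
      ext i
      exact mul_comm _ _

/-- **An idempotent matrix over a local ring is diagonalisable with eigenvalues `0, 1` by a base change of
determinant one**: `Rⁿ = im E ⊕ ker E` with both summands finitely generated projective, hence free
(Milnor's Lemma 1.2 «If Λ is a local ring, then every finitely generated projective is free», the tree's
`free_range_toLin'_of_isLocalRing`); a basis adapted to the decomposition is the required `P` — a direct
consequence of the cited lemma.  [cite: Milnor1972, §1 Lemma 1.2] -/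
theorem exists_det_eq_one_mul_eq_mul_diagonal_of_isIdempotentElem [IsLocalRing R] (E : Matrix n n R)
    (hE : IsIdempotentElem E) :
    ∃ P : Matrix n n R, P.det = 1 ∧ ∃ d : n → R, (∀ i, d i = 0 ∨ d i = 1) ∧ E * P = P * diagonal d := by
  classical
  set f := Matrix.toLin' E with hf
  have hff : IsIdempotentElem f := by
    change f * f = f
    rw [hf, Module.End.mul_eq_comp, ← Matrix.toLin'_mul, hE.eq]
  have hfix : ∀ v ∈ LinearMap.range f, f v = v := by
    rintro v ⟨w, rfl⟩
    change (f * f) w = f w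
    rw [hff.eq]
  have hc : IsCompl (LinearMap.range f) (LinearMap.ker f) := LinearMap.IsIdempotentElem.isCompl hff
  have hker : LinearMap.ker f = LinearMap.range (Matrix.toLin' (1 - E)) := by
    ext v
    constructor
    · intro hv
      rw [LinearMap.mem_ker, hf, Matrix.toLin'_apply] at hv
      exact ⟨v, by rw [Matrix.toLin'_apply, sub_mulVec, one_mulVec, hv, sub_zero]⟩
    · rintro ⟨w, rfl⟩
      rw [LinearMap.mem_ker, hf, Matrix.toLin'_apply, Matrix.toLin'_apply, mulVec_mulVec, Matrix.mul_sub,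
        Matrix.mul_one, hE.eq, sub_self, zero_mulVec]
  haveI : Module.Free R (LinearMap.range f) :=
    Literature.RingTheory.KTheory.free_range_toLin'_of_isLocalRing hE
  haveI : Module.Free R (LinearMap.ker f) := by
    rw [hker]; exact Literature.RingTheory.KTheory.free_range_toLin'_of_isLocalRing hE.one_sub
  haveI : Module.Finite R (LinearMap.range f) := Module.Finite.range f
  haveI : Module.Finite R (LinearMap.ker f) := by rw [hker]; exact Module.Finite.range _
  let bV := Module.Free.chooseBasis R (LinearMap.range f)
  let bW := Module.Free.chooseBasis R (LinearMap.ker f)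
  let e := Submodule.prodEquivOfIsCompl _ _ hc
  let b₀ := (bV.prod bW).map e
  let σ := b₀.indexEquiv (Pi.basisFun R n)
  let b := b₀.reindex σ
  -- the base-change matrix with columns `b j` and the eigenvalue pattern
  let P : Matrix n n R := Matrix.of fun i j => b j i
  let d : n → R := fun j => Sum.elim (fun _ => (1 : R)) (fun _ => 0) (σ.symm j)
  have hPb : P = (Pi.basisFun R n).toMatrix b := by
    ext i j
    rw [Module.Basis.toMatrix_apply, Pi.basisFun_repr]
    rfl
  have hPdet : IsUnit P.det := by
    rw [hPb, ← Module.Basis.det_apply]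
    exact Module.Basis.isUnit_det _ _
  have hEP : E * P = P * diagonal d := by
    ext i j
    have hl : (E * P) i j = f (b j) i := by
      rw [hf, Matrix.toLin'_apply]
      simp only [Matrix.mul_apply, Matrix.mulVec, dotProduct, P, Matrix.of_apply]
    have hr : (P * diagonal d) i j = b j i * d j := Matrix.mul_diagonal _ _ _ _
    rw [hl, hr]
    have hbj : b j = e ((bV.prod bW) (σ.symm j)) := by
      rw [Module.Basis.reindex_apply, Module.Basis.map_apply]
    generalize hx : σ.symm j = x at hbj
    simp only [d, hx]
    cases x with
    | inl a =>
      have hmem : b j ∈ LinearMap.range f := by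
        rw [hbj, Submodule.coe_prodEquivOfIsCompl', Module.Basis.prod_apply_inl_fst,
          Module.Basis.prod_apply_inl_snd, Submodule.coe_zero, add_zero]
        exact Submodule.coe_mem _
      rw [hfix _ hmem, Sum.elim_inl, mul_one]
    | inr c =>
      have hmem : b j ∈ LinearMap.ker f := by
        rw [hbj, Submodule.coe_prodEquivOfIsCompl', Module.Basis.prod_apply_inr_fst,
          Module.Basis.prod_apply_inr_snd, Submodule.coe_zero, zero_add]
        exact Submodule.coe_mem _
      rw [LinearMap.mem_ker] at hmem
      rw [hmem, Sum.elim_inr, mul_zero, Pi.zero_apply]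
  obtain ⟨P', hP'det, hEP'⟩ := exists_det_eq_one_mul_eq_mul_diagonal hPdet hEP
  refine ⟨P', hP'det, d, fun i => ?_, hEP'⟩
  simp only [d]
  cases σ.symm i with
  | inl a => exact Or.inr rfl
  | inr c => exact Or.inl rfl

/-- **Relative version** (for the «moreover» clause of Goresky–Tai's Lemma 26): the idempotent block matrix
`(1 E₁₂; 0 E₂₂)` (idempotency amounts to `E₂₂² = E₂₂` and `E₁₂E₂₂ = 0`) is diagonalised by a base change
`(1 X; 0 Y)` with `det Y = 1` which keeps the first block of basis vectors fixed — `X = −E₁₂Y` with `Y`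
diagonalising `E₂₂` (the idempotent form of «it is possible to choose `p` to be of the form `p = (I_q 0; * *)`»).
[cite: GoreskyTai2003RealModuli, §10.1 Lemma 26 («moreover» clause)] [cite: Milnor1972, §1 Lemma 1.2] -/
theorem exists_fromBlocks_mul_eq_mul_diagonal_of_isIdempotentElem [IsLocalRing R] {S T : Type*} [Fintype S]
    [DecidableEq S] [Fintype T] [DecidableEq T] (E₁₂ : Matrix S T R) {E₂₂ : Matrix T T R}
    (hE : IsIdempotentElem E₂₂) (h₁₂ : E₁₂ * E₂₂ = 0) :
    ∃ X : Matrix S T R, ∃ Y : Matrix T T R, Y.det = 1 ∧ ∃ d : T → R, (∀ i, d i = 0 ∨ d i = 1) ∧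
      fromBlocks (1 : Matrix S S R) E₁₂ 0 E₂₂ * fromBlocks (1 : Matrix S S R) X 0 Y =
        fromBlocks (1 : Matrix S S R) X 0 Y * diagonal (Sum.elim (fun _ => (1 : R)) d) := by
  obtain ⟨Y, hY, d, hd, hEY⟩ := exists_det_eq_one_mul_eq_mul_diagonal_of_isIdempotentElem E₂₂ hE
  refine ⟨-(E₁₂ * Y), Y, hY, d, hd, ?_⟩
  have hXD : -(E₁₂ * Y) * diagonal d = 0 := by
    rw [Matrix.neg_mul, Matrix.mul_assoc, ← hEY, ← Matrix.mul_assoc, h₁₂, Matrix.zero_mul, neg_zero]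
  rw [← diagonal_one, ← fromBlocks_diagonal, diagonal_one, fromBlocks_multiply, fromBlocks_multiply]
  simp only [Matrix.mul_one, Matrix.one_mul, Matrix.mul_zero, Matrix.zero_mul, add_zero, zero_add,
    Matrix.mul_neg, neg_add_cancel, neg_zero, hXD, hEY]

end LocalRing

/-! ## §2. Reductions modulo `N` and lifts to `SL_n(ℤ)` -/

section Reduction

variable {m n : Type*}

/-- Two integer matrices have the same reduction modulo `N` iff they are entrywise congruent modulo `N`.
[folklore] -/
private theorem map_intCast_zmod_eq_map_iff_forall_modEq {N : ℕ} (X Y : Matrix m n ℤ) :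
    X.map (Int.castRingHom (ZMod N)) = Y.map (Int.castRingHom (ZMod N)) ↔ ∀ i j, X i j ≡ Y i j [ZMOD N] := by
  simp only [← Matrix.ext_iff, map_apply, eq_intCast, ZMod.intCast_eq_intCast_iff]

/-- An integer matrix reduces to `0` modulo `N` iff `N` divides every entry.  [folklore] -/
private theorem map_intCast_zmod_eq_zero_iff_forall_dvd {N : ℕ} (X : Matrix m n ℤ) :
    X.map (Int.castRingHom (ZMod N)) = 0 ↔ ∀ i j, (N : ℤ) ∣ X i j := by
  simp only [← Matrix.ext_iff, map_apply, eq_intCast, Matrix.zero_apply, ZMod.intCast_zmod_eq_zero_iff_dvd]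

/-- The reduction of `diag(d)` is `diag(d mod N)`.  [folklore] -/
private theorem diagonal_map_intCast_zmod [DecidableEq n] {N : ℕ} (d : n → ℤ) :
    (diagonal d).map (Int.castRingHom (ZMod N)) = diagonal fun i => (d i : ZMod N) := by
  rw [diagonal_map (map_zero _)]
  rfl

variable [Fintype n] [DecidableEq n]

/-- The reduction of a special linear matrix under `SpecialLinearGroup.map` is its entrywise reduction.
[folklore] -/
private theorem coe_specialLinearGroup_map_intCast {N : ℕ} (P : Matrix.SpecialLinearGroup n ℤ) :
    ((Matrix.SpecialLinearGroup.map (Int.castRingHom (ZMod N)) P : Matrix.SpecialLinearGroup n (ZMod N)) :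
      Matrix n n (ZMod N)) = (P : Matrix n n ℤ).map (Int.castRingHom (ZMod N)) :=
  rfl

/-- **Lifting a determinant-one base change**: if `Ē P̄ = P̄ diag(d̄)` over `ℤ/Nℤ` with `det P̄ = 1`, where `Ē`,
`d̄` are reductions of integral `E`, `d`, then some `P ∈ SL_n(ℤ)` reducing to `P̄` has `EP ≡ P diag(d) (mod N)`
(the tree's surjectivity `SL_n(ℤ) → SL_n(ℤ/Nℤ)`, Andrianov–Zhuravlev Lemma 3.2 (1)).
[cite: AndrianovZhuravlev2015, Chap. 3 Lemma 3.2 (1)] -/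
theorem exists_specialLinearGroup_map_eq_and_mul_map_eq {N : ℕ} [NeZero N] (E : Matrix n n ℤ) (d : n → ℤ)
    {Pbar : Matrix n n (ZMod N)} (hdet : Pbar.det = 1)
    (h : E.map (Int.castRingHom (ZMod N)) * Pbar = Pbar * (diagonal d).map (Int.castRingHom (ZMod N))) :
    ∃ P : Matrix.SpecialLinearGroup n ℤ, (P : Matrix n n ℤ).map (Int.castRingHom (ZMod N)) = Pbar ∧
      (E * (P : Matrix n n ℤ)).map (Int.castRingHom (ZMod N)) =
        ((P : Matrix n n ℤ) * diagonal d).map (Int.castRingHom (ZMod N)) := by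
  obtain ⟨P, hP⟩ :=
    Literature.LinearAlgebra.Matrix.IntegerSpecialLinear.exists_specialLinearGroup_map_intCast_eq N ⟨Pbar, hdet⟩
  have hc : (P : Matrix n n ℤ).map (Int.castRingHom (ZMod N)) = Pbar := by
    rw [← coe_specialLinearGroup_map_intCast, hP]
  exact ⟨P, hc, by rw [Matrix.map_mul, hc, h, Matrix.map_mul, hc]⟩

/-- **Relative lift**: a block matrix `(1 X̄; 0 Ȳ)` over `ℤ/Nℤ` with `det Ȳ = 1` is the reduction of an integral
`(1 X; 0 Y)` with `Y ∈ SL(ℤ)` — the identity columns are kept exactly.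
[cite: AndrianovZhuravlev2015, Chap. 3 Lemma 3.2 (1)] -/
theorem exists_fromBlocks_map_intCast_eq {N : ℕ} [NeZero N] {S T : Type*} [Fintype S] [DecidableEq S]
    [Fintype T] [DecidableEq T] (Xbar : Matrix S T (ZMod N)) {Ybar : Matrix T T (ZMod N)} (hY : Ybar.det = 1) :
    ∃ X : Matrix S T ℤ, ∃ Y : Matrix.SpecialLinearGroup T ℤ,
      (fromBlocks (1 : Matrix S S ℤ) X 0 (Y : Matrix T T ℤ)).map (Int.castRingHom (ZMod N)) =
        fromBlocks (1 : Matrix S S (ZMod N)) Xbar 0 Ybar := by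
  obtain ⟨Y, hYl⟩ :=
    Literature.LinearAlgebra.Matrix.IntegerSpecialLinear.exists_specialLinearGroup_map_intCast_eq N ⟨Ybar, hY⟩
  have hc : (Y : Matrix T T ℤ).map (Int.castRingHom (ZMod N)) = Ybar := by
    rw [← coe_specialLinearGroup_map_intCast, hYl]
  refine ⟨Xbar.map ZMod.cast, Y, ?_⟩
  rw [fromBlocks_map, hc, Matrix.map_map, Matrix.map_one _ (map_zero _) (map_one _),
    Matrix.map_zero _ (map_zero _)]
  congr 1
  ext i j
  simp only [map_apply, Function.comp_apply, eq_intCast, ZMod.intCast_zmod_cast]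

end Reduction

/-! ## §3. Goresky–Tai's Lemma 26: `A ≡ I (2)`, `A² ≡ I (2^{k+1})` ⟹ `AP ≡ P·diag(±1) (2^k)` with `P ∈ SL_n(ℤ)` -/

section Integer

variable {m n : Type*}

/-- An integer matrix which vanishes modulo `N` is `N` times an integer matrix.  [folklore] -/
private theorem exists_natCast_smul_eq_of_map_intCast_zmod_eq_zero {N : ℕ} {X : Matrix m n ℤ}
    (h : X.map (Int.castRingHom (ZMod N)) = 0) : ∃ E : Matrix m n ℤ, (N : ℤ) • E = X := by
  rw [map_intCast_zmod_eq_zero_iff_forall_dvd] at h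
  refine ⟨Matrix.of fun i j => X i j / N, ?_⟩
  ext i j
  simp only [Matrix.smul_apply, Matrix.of_apply, smul_eq_mul]
  exact Int.mul_ediv_cancel' (h i j)

variable [Fintype n] [DecidableEq n]

/-- «`A ≡ I mod 2`» makes `E = (A + I)/2` integral: `2E = A + I` for some integer matrix `E`.
[cite: GoreskyTai2003RealModuli, §10.1 Lemma 26 (proof, §10.4)] -/
theorem exists_two_smul_eq_add_one {A : Matrix n n ℤ} (h1 : A.map (Int.castRingHom (ZMod 2)) = 1) :
    ∃ E : Matrix n n ℤ, (2 : ℤ) • E = A + 1 := by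
  have h0 : (A + 1).map (Int.castRingHom (ZMod 2)) = 0 := by
    rw [← RingHom.mapMatrix_apply, map_add, map_one, RingHom.mapMatrix_apply, h1]
    ext i j
    rw [Matrix.add_apply, Matrix.one_apply, Matrix.zero_apply]
    split_ifs <;> decide
  simpa using exists_natCast_smul_eq_of_map_intCast_zmod_eq_zero h0

/-- With `2E = A + I`: `4(E² − E) = A² − I`.  [cite: GoreskyTai2003RealModuli, §10.1 Lemma 26 (proof, §10.4)] -/
theorem four_smul_mul_sub_eq_of_two_smul_eq {A E : Matrix n n ℤ} (hE : (2 : ℤ) • E = A + 1) :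
    (4 : ℤ) • (E * E - E) = A * A - 1 := by
  have h4 : (4 : ℤ) • (E * E - E) = ((2 : ℤ) • E) * ((2 : ℤ) • E) - (2 : ℤ) • ((2 : ℤ) • E) := by
    rw [smul_mul_assoc, mul_smul_comm, smul_smul, smul_smul, smul_sub]
    norm_num
  rw [h4, hE, two_smul, add_mul, mul_add, mul_one, one_mul]
  abel

/-- **The idempotent.**  If `2E = A + I` and `A² ≡ I (mod 2^{j+3})` then `E mod 2^{j+1}` is an idempotent matrix
over `ℤ/2^{j+1}ℤ` (`E² − E = (A² − I)/4`).  [cite: GoreskyTai2003RealModuli, §10.1 Lemma 26 (proof, §10.4)] -/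
theorem isIdempotentElem_map_of_two_smul_eq {j : ℕ} {A E : Matrix n n ℤ} (hE : (2 : ℤ) • E = A + 1)
    (h2 : (A * A).map (Int.castRingHom (ZMod (2 ^ (j + 3)))) = 1) :
    IsIdempotentElem (E.map (Int.castRingHom (ZMod (2 ^ (j + 1))))) := by
  have hAA : (A * A - 1).map (Int.castRingHom (ZMod (2 ^ (j + 3)))) = 0 := by
    rw [← RingHom.mapMatrix_apply, map_sub, map_one, RingHom.mapMatrix_apply, h2, sub_self]
  rw [map_intCast_zmod_eq_zero_iff_forall_dvd] at hAA
  have hEE : (E * E - E).map (Int.castRingHom (ZMod (2 ^ (j + 1)))) = 0 := by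
    refine (map_intCast_zmod_eq_zero_iff_forall_dvd _).2 fun i l => ?_
    have h := hAA i l
    rw [← four_smul_mul_sub_eq_of_two_smul_eq hE, Matrix.smul_apply, smul_eq_mul] at h
    have h43 : ((2 ^ (j + 3) : ℕ) : ℤ) = 4 * ((2 ^ (j + 1) : ℕ) : ℤ) := by push_cast; ring
    rw [h43] at h
    exact (mul_dvd_mul_iff_left (by norm_num : (4 : ℤ) ≠ 0)).1 h
  change E.map _ * E.map _ = E.map _
  rw [← Matrix.map_mul, ← sub_eq_zero, ← Matrix.map_sub _ (map_sub (Int.castRingHom (ZMod (2 ^ (j + 1))))), hEE]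

/-- **From the idempotent back to `A`.**  If `2E = A + I` and `EP ≡ P diag(d) (mod 2^{j+1})` then
`AP ≡ P diag(2d − 1) (mod 2^{j+2})` (`A = 2E − I`).  [cite: GoreskyTai2003RealModuli, §10.1 Lemma 26 (proof, §10.4)] -/
theorem mul_map_eq_mul_diagonal_map_of_two_smul_eq {j : ℕ} {A E P : Matrix n n ℤ} {d : n → ℤ}
    (hE : (2 : ℤ) • E = A + 1)
    (h : (E * P).map (Int.castRingHom (ZMod (2 ^ (j + 1)))) =
      (P * diagonal d).map (Int.castRingHom (ZMod (2 ^ (j + 1))))) :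
    (A * P).map (Int.castRingHom (ZMod (2 ^ (j + 2)))) =
      (P * diagonal fun i => 2 * d i - 1).map (Int.castRingHom (ZMod (2 ^ (j + 2)))) := by
  rw [map_intCast_zmod_eq_map_iff_forall_modEq] at h ⊢
  intro i l
  have hA : A = (2 : ℤ) • E - 1 := by rw [hE, add_sub_cancel_right]
  have hl : (A * P) i l = 2 * (E * P) i l - P i l := by
    rw [hA, Matrix.sub_mul, smul_mul_assoc, Matrix.one_mul, Matrix.sub_apply, Matrix.smul_apply, smul_eq_mul]
  have hr : (P * diagonal fun i => 2 * d i - 1) i l = 2 * (P * diagonal d) i l - P i l := by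
    rw [mul_diagonal, mul_diagonal]
    ring
  rw [hl, hr]
  have h3 := Int.ModEq.mul_left' (c := 2) (h i l)
  have hmod : (2 : ℤ) * ((2 ^ (j + 1) : ℕ) : ℤ) = ((2 ^ (j + 2) : ℕ) : ℤ) := by push_cast; ring
  rw [hmod] at h3
  exact h3.sub_right _

/-- The two trivial levels: for `k ≤ 1` the conclusion of Lemma 26 modulo `2^k` already follows from `A ≡ I (mod 2)`
with `P = I`, `ε = (1, …, 1)`.  [cite: GoreskyTai2003RealModuli, §10.1 Lemma 26] -/
theorem mul_one_map_eq_of_le_one {k : ℕ} (hk : k ≤ 1) {A : Matrix n n ℤ} (h1 : A.map (Int.castRingHom (ZMod 2)) = 1) :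
    (A * 1).map (Int.castRingHom (ZMod (2 ^ k))) =
      ((1 : Matrix n n ℤ) * diagonal fun _ => (1 : ℤ)).map (Int.castRingHom (ZMod (2 ^ k))) := by
  rw [Matrix.mul_one, diagonal_one, Matrix.mul_one, map_intCast_zmod_eq_map_iff_forall_modEq]
  have h1' := (map_intCast_zmod_eq_map_iff_forall_modEq A 1).1
    (by rw [h1, Matrix.map_one _ (map_zero _) (map_one _)])
  intro i l
  refine Int.ModEq.of_dvd ?_ (h1' i l)
  interval_cases k <;> norm_num

/-- **Goresky–Tai 2003, Lemma 26 (main clause).**  «Let `A ∈ GL(n, ℤ)`.  Suppose that `A ≡ I mod 2` and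
`A² ≡ I mod 2^{k+1}`.  Then there exists `p ∈ GL(n, ℤ)` so that `p⁻¹Ap ≡ diag(±1, …, ±1) mod 2^k`.»  Here for ANY
square integer matrix `A` (invertibility is not used), with `p = P ∈ SL_n(ℤ)`, in the form `AP ≡ P·diag(ε) (mod 2^k)`,
`ε ∈ {±1}ⁿ`.  Proof (announced deviation from the printed induction on the rank): `E = (A + I)/2` reduces to an
idempotent over the local ring `ℤ/2^{k−1}ℤ` (`isIdempotentElem_map_of_two_smul_eq`), which is diagonalised by a
determinant-one base change (`exists_det_eq_one_mul_eq_mul_diagonal_of_isIdempotentElem`) that lifts to `SL_n(ℤ)`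
(`exists_specialLinearGroup_map_eq_and_mul_map_eq`); doubling the modulus gives the claim for `A = 2E − I`.
[cite: GoreskyTai2003RealModuli, §10.1 Lemma 26] -/
theorem exists_specialLinearGroup_mul_map_eq_mul_diagonal (k : ℕ) (A : Matrix n n ℤ)
    (h1 : A.map (Int.castRingHom (ZMod 2)) = 1)
    (h2 : (A * A).map (Int.castRingHom (ZMod (2 ^ (k + 1)))) = 1) :
    ∃ P : Matrix.SpecialLinearGroup n ℤ, ∃ ε : n → ℤ, (∀ i, ε i = 1 ∨ ε i = -1) ∧
      (A * (P : Matrix n n ℤ)).map (Int.castRingHom (ZMod (2 ^ k))) =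
        ((P : Matrix n n ℤ) * diagonal ε).map (Int.castRingHom (ZMod (2 ^ k))) := by
  match k, h2 with
  | 0, _ => exact ⟨1, fun _ => 1, fun _ => Or.inl rfl, mul_one_map_eq_of_le_one zero_le_one h1⟩
  | 1, _ => exact ⟨1, fun _ => 1, fun _ => Or.inl rfl, mul_one_map_eq_of_le_one le_rfl h1⟩
  | j + 2, h2 =>
    obtain ⟨E, hE⟩ := exists_two_smul_eq_add_one h1
    haveI : Fact (Nat.Prime 2) := ⟨Nat.prime_two⟩
    haveI : IsLocalRing (ZMod (2 ^ (j + 1))) := isLocalRing_zmod_prime_pow 2 j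
    haveI : NeZero (2 ^ (j + 1)) := ⟨pow_ne_zero _ two_ne_zero⟩
    have hidem : IsIdempotentElem (E.map (Int.castRingHom (ZMod (2 ^ (j + 1))))) :=
      isIdempotentElem_map_of_two_smul_eq hE h2
    obtain ⟨Pbar, hdet, dbar, hdbar, hEP⟩ := exists_det_eq_one_mul_eq_mul_diagonal_of_isIdempotentElem _ hidem
    let d : n → ℤ := fun i => if dbar i = 1 then 1 else 0
    have hd : (diagonal d).map (Int.castRingHom (ZMod (2 ^ (j + 1)))) = diagonal dbar := by
      rw [diagonal_map_intCast_zmod]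
      congr 1
      ext i
      simp only [d]
      rcases hdbar i with h | h
      · rw [h, if_neg zero_ne_one, Int.cast_zero]
      · rw [h, if_pos rfl, Int.cast_one]
    obtain ⟨P, -, hP⟩ := exists_specialLinearGroup_map_eq_and_mul_map_eq E d hdet (by rw [hd]; exact hEP)
    refine ⟨P, fun i => 2 * d i - 1, fun i => ?_, mul_map_eq_mul_diagonal_map_of_two_smul_eq hE hP⟩
    simp only [d]
    split_ifs <;> norm_num

/-- For `P ∈ SL_n(ℤ)`, `AP ≡ PD (mod N)` is the printed `P⁻¹AP ≡ D (mod N)`.  [folklore] -/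
private theorem inv_mul_mul_map_eq_of_mul_map_eq {N : ℕ} {A D : Matrix n n ℤ} (P : Matrix.SpecialLinearGroup n ℤ)
    (h : (A * (P : Matrix n n ℤ)).map (Int.castRingHom (ZMod N)) =
      ((P : Matrix n n ℤ) * D).map (Int.castRingHom (ZMod N))) :
    (((P⁻¹ : Matrix.SpecialLinearGroup n ℤ) : Matrix n n ℤ) * A * P).map (Int.castRingHom (ZMod N)) =
      D.map (Int.castRingHom (ZMod N)) := by
  have hinv : (((P⁻¹ : Matrix.SpecialLinearGroup n ℤ) : Matrix n n ℤ)).map (Int.castRingHom (ZMod N)) *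
      (P : Matrix n n ℤ).map (Int.castRingHom (ZMod N)) = 1 := by
    rw [← Matrix.map_mul, ← Matrix.SpecialLinearGroup.coe_mul, inv_mul_cancel, Matrix.SpecialLinearGroup.coe_one,
      Matrix.map_one _ (map_zero _) (map_one _)]
  rw [Matrix.mul_assoc, Matrix.map_mul, h, Matrix.map_mul, ← Matrix.mul_assoc, hinv, Matrix.one_mul]

/-- **Goresky–Tai 2003, Lemma 26, as printed: `p⁻¹Ap ≡ diag(±1, …, ±1) mod 2^k`** (entrywise congruences of
integer matrices, `p = P ∈ SL_n(ℤ) ⊆ GL(n, ℤ)`, `p⁻¹` the integral inverse).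
[cite: GoreskyTai2003RealModuli, §10.1 Lemma 26] -/
theorem exists_specialLinearGroup_conj_modEq_diagonal (k : ℕ) (A : Matrix n n ℤ)
    (h1 : A.map (Int.castRingHom (ZMod 2)) = 1)
    (h2 : (A * A).map (Int.castRingHom (ZMod (2 ^ (k + 1)))) = 1) :
    ∃ P : Matrix.SpecialLinearGroup n ℤ, ∃ ε : n → ℤ, (∀ i, ε i = 1 ∨ ε i = -1) ∧
      ∀ i j, (((P⁻¹ : Matrix.SpecialLinearGroup n ℤ) : Matrix n n ℤ) * A * P) i j ≡ diagonal ε i j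
        [ZMOD (2 ^ k : ℕ)] := by
  obtain ⟨P, ε, hε, h⟩ := exists_specialLinearGroup_mul_map_eq_mul_diagonal k A h1 h2
  exact ⟨P, ε, hε, (map_intCast_zmod_eq_map_iff_forall_modEq _ _).1 (inv_mul_mul_map_eq_of_mul_map_eq P h)⟩

end Integer

/-! ## §4. The «moreover» clause: identity columns are kept (block form, column convention) -/

section Blocks

variable {S T : Type*} [Fintype S] [DecidableEq S] [Fintype T] [DecidableEq T]

/-- The determinant of `(1 X; 0 Y)` is `det Y`.  [folklore] -/
private theorem det_fromBlocks_one_zero {R : Type*} [CommRing R] (X : Matrix S T R) (Y : Matrix T T R) :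
    (fromBlocks (1 : Matrix S S R) X 0 Y).det = Y.det := by
  rw [det_fromBlocks_zero₂₁, det_one, one_mul]

/-- **Goresky–Tai 2003, Lemma 26, «moreover» clause (column convention).**  If in addition `A` fixes the basis
vectors `e_j`, `j ∈ S` — `A = (1 A₁₂; 0 A₂₂)` on `S ⊕ T` — then the base change may be chosen of the form
`P = (1 X; 0 Y)`, `Y ∈ SL_T(ℤ)` (so `P ∈ SL(ℤ)` keeps the `e_j`, `j ∈ S`, and `ε_j = 1` there):
`AP ≡ P·diag(1, ε) (mod 2^k)`.  Proof: the relative diagonalisation of the idempotent `(1 Ē₁₂; 0 Ē₂₂)`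
(`exists_fromBlocks_mul_eq_mul_diagonal_of_isIdempotentElem`, using `Ē₁₂Ē₂₂ = 0`) and the relative lift
`exists_fromBlocks_map_intCast_eq`.  GT print the transposed (row) convention «`A = (I_q 0; * *)` … `p = (I_q 0; * *)`»,
derived below (`exists_specialLinearGroup_fromBlocks_conj_map_eq_diagonal`); their proof passes to the quotient
module `M/M′` instead.  [cite: GoreskyTai2003RealModuli, §10.1 Lemma 26] -/
theorem exists_fromBlocks_mul_map_eq_mul_diagonal (k : ℕ) (A₁₂ : Matrix S T ℤ) (A₂₂ : Matrix T T ℤ)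
    (h1 : (fromBlocks (1 : Matrix S S ℤ) A₁₂ 0 A₂₂).map (Int.castRingHom (ZMod 2)) = 1)
    (h2 : (fromBlocks (1 : Matrix S S ℤ) A₁₂ 0 A₂₂ * fromBlocks (1 : Matrix S S ℤ) A₁₂ 0 A₂₂).map
      (Int.castRingHom (ZMod (2 ^ (k + 1)))) = 1) :
    ∃ X : Matrix S T ℤ, ∃ Y : Matrix.SpecialLinearGroup T ℤ, ∃ ε : T → ℤ, (∀ i, ε i = 1 ∨ ε i = -1) ∧
      (fromBlocks (1 : Matrix S S ℤ) A₁₂ 0 A₂₂ * fromBlocks (1 : Matrix S S ℤ) X 0 (Y : Matrix T T ℤ)).map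
          (Int.castRingHom (ZMod (2 ^ k))) =
        (fromBlocks (1 : Matrix S S ℤ) X 0 (Y : Matrix T T ℤ) *
          diagonal (Sum.elim (fun _ => (1 : ℤ)) ε)).map (Int.castRingHom (ZMod (2 ^ k))) := by
  -- the trivial levels `k ≤ 1`
  have triv : k ≤ 1 → ∃ X : Matrix S T ℤ, ∃ Y : Matrix.SpecialLinearGroup T ℤ, ∃ ε : T → ℤ,
      (∀ i, ε i = 1 ∨ ε i = -1) ∧
      (fromBlocks (1 : Matrix S S ℤ) A₁₂ 0 A₂₂ * fromBlocks (1 : Matrix S S ℤ) X 0 (Y : Matrix T T ℤ)).map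
          (Int.castRingHom (ZMod (2 ^ k))) =
        (fromBlocks (1 : Matrix S S ℤ) X 0 (Y : Matrix T T ℤ) *
          diagonal (Sum.elim (fun _ => (1 : ℤ)) ε)).map (Int.castRingHom (ZMod (2 ^ k))) := by
    intro hk
    refine ⟨0, 1, fun _ => 1, fun _ => Or.inl rfl, ?_⟩
    have h := mul_one_map_eq_of_le_one hk h1
    rw [Matrix.SpecialLinearGroup.coe_one, fromBlocks_one]
    convert h using 3
    ext i
    cases i <;> rfl
  rcases Nat.lt_or_ge k 2 with hk | hk
  · exact triv (by omega)
  · obtain ⟨j, rfl⟩ := Nat.exists_eq_add_of_le' hk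
    haveI : Fact (Nat.Prime 2) := ⟨Nat.prime_two⟩
    haveI : IsLocalRing (ZMod (2 ^ (j + 1))) := isLocalRing_zmod_prime_pow 2 j
    haveI : NeZero (2 ^ (j + 1)) := ⟨pow_ne_zero _ two_ne_zero⟩
    -- blocks of `A mod 2`
    have hb : A₁₂.map (Int.castRingHom (ZMod 2)) = 0 ∧ A₂₂.map (Int.castRingHom (ZMod 2)) = 1 := by
      rw [fromBlocks_map, Matrix.map_one _ (map_zero _) (map_one _), Matrix.map_zero _ (map_zero _),
        ← fromBlocks_one] at h1
      obtain ⟨-, h12, -, h22⟩ := Matrix.fromBlocks_inj.1 h1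
      exact ⟨h12, h22⟩
    obtain ⟨E₁₂, hE₁₂⟩ := exists_natCast_smul_eq_of_map_intCast_zmod_eq_zero hb.1
    rw [Nat.cast_ofNat] at hE₁₂
    obtain ⟨E₂₂, hE₂₂⟩ := exists_two_smul_eq_add_one hb.2
    -- the integral `E = (A + 1)/2 = (1 E₁₂; 0 E₂₂)`
    have hE : (2 : ℤ) • fromBlocks (1 : Matrix S S ℤ) E₁₂ 0 E₂₂ = fromBlocks (1 : Matrix S S ℤ) A₁₂ 0 A₂₂ + 1 := by
      rw [fromBlocks_smul, hE₁₂, hE₂₂, smul_zero, ← fromBlocks_one, fromBlocks_add, add_zero, add_zero, two_smul]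
    have hidem := isIdempotentElem_map_of_two_smul_eq hE h2
    rw [fromBlocks_map, Matrix.map_one _ (map_zero _) (map_one _), Matrix.map_zero _ (map_zero _)] at hidem
    have hblocks : E₁₂.map (Int.castRingHom (ZMod (2 ^ (j + 1)))) * E₂₂.map (Int.castRingHom (ZMod (2 ^ (j + 1)))) = 0 ∧
        IsIdempotentElem (E₂₂.map (Int.castRingHom (ZMod (2 ^ (j + 1))))) := by
      have h := hidem.eq
      rw [fromBlocks_multiply] at h
      simp only [Matrix.mul_one, Matrix.one_mul, Matrix.mul_zero, Matrix.zero_mul, add_zero, zero_add] at h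
      obtain ⟨-, h12, -, h22⟩ := Matrix.fromBlocks_inj.1 h
      exact ⟨add_eq_left.1 h12, h22⟩
    obtain ⟨Xbar, Ybar, hYdet, dbar, hdbar, hrel⟩ :=
      exists_fromBlocks_mul_eq_mul_diagonal_of_isIdempotentElem _ hblocks.2 hblocks.1
    -- integral eigenvalue pattern
    let d : T → ℤ := fun i => if dbar i = 1 then 1 else 0
    have hd : (diagonal (Sum.elim (fun (_ : S) => (1 : ℤ)) d)).map (Int.castRingHom (ZMod (2 ^ (j + 1)))) =
        diagonal (Sum.elim (fun (_ : S) => (1 : ZMod (2 ^ (j + 1)))) dbar) := by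
      rw [diagonal_map_intCast_zmod]
      congr 1
      ext i
      cases i with
      | inl a => exact Int.cast_one
      | inr c =>
        simp only [Sum.elim_inr, d]
        rcases hdbar c with h | h
        · rw [h, if_neg zero_ne_one, Int.cast_zero]
        · rw [h, if_pos rfl, Int.cast_one]
    -- the relative lift
    obtain ⟨X, Y, hXY⟩ := exists_fromBlocks_map_intCast_eq Xbar hYdet
    have hEP : (fromBlocks (1 : Matrix S S ℤ) E₁₂ 0 E₂₂ * fromBlocks (1 : Matrix S S ℤ) X 0 (Y : Matrix T T ℤ)).map
          (Int.castRingHom (ZMod (2 ^ (j + 1)))) =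
        (fromBlocks (1 : Matrix S S ℤ) X 0 (Y : Matrix T T ℤ) * diagonal (Sum.elim (fun _ => (1 : ℤ)) d)).map
          (Int.castRingHom (ZMod (2 ^ (j + 1)))) := by
      rw [Matrix.map_mul, Matrix.map_mul, hXY, hd, fromBlocks_map, Matrix.map_one _ (map_zero _) (map_one _),
        Matrix.map_zero _ (map_zero _), hrel]
    refine ⟨X, Y, fun i => 2 * d i - 1, fun i => ?_, ?_⟩
    · simp only [d]
      split_ifs <;> norm_num
    · have hfun : (fun i => 2 * Sum.elim (fun (_ : S) => (1 : ℤ)) d i - 1) =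
          Sum.elim (fun (_ : S) => (1 : ℤ)) (fun i => 2 * d i - 1) := by
        funext i
        cases i with
        | inl a => simp
        | inr c => simp
      have h := mul_map_eq_mul_diagonal_map_of_two_smul_eq hE hEP
      rw [hfun] at h
      exact h

/-! ## §5. The printed row convention: `A = (I_q 0; * *)`, `p = (I_q 0; * *)`, `p⁻¹Ap ≡ diag(±1) (2^k)` -/

/-- **Goresky–Tai 2003, Lemma 26 with its «moreover» clause, as printed (row convention).**  «Moreover if the
matrix of `A` with respect to the standard basis of `ℤⁿ` is `(I_q 0; * *)` then it is possible to choose `p` to be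
of the form `p = (I_q 0; * *)`»: for `A = (1 0; A₂₁ A₂₂)` on `S ⊕ T` with `A ≡ I (mod 2)`, `A² ≡ I (mod 2^{k+1})`
there is `p = (1 0; p₂₁ p₂₂) ∈ SL(ℤ)` with `p⁻¹Ap ≡ diag(1, …, 1, ε) (mod 2^k)`, `ε ∈ {±1}^T`.  Obtained from the
column version for `ᵗA` by transposing and inverting (`p = (ᵗP)⁻¹`, again of the printed shape).
[cite: GoreskyTai2003RealModuli, §10.1 Lemma 26] -/
theorem exists_specialLinearGroup_fromBlocks_conj_map_eq_diagonal (k : ℕ) (A₂₁ : Matrix T S ℤ)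
    (A₂₂ : Matrix T T ℤ)
    (h1 : (fromBlocks (1 : Matrix S S ℤ) 0 A₂₁ A₂₂).map (Int.castRingHom (ZMod 2)) = 1)
    (h2 : (fromBlocks (1 : Matrix S S ℤ) 0 A₂₁ A₂₂ * fromBlocks (1 : Matrix S S ℤ) 0 A₂₁ A₂₂).map
      (Int.castRingHom (ZMod (2 ^ (k + 1)))) = 1) :
    ∃ p : Matrix.SpecialLinearGroup (S ⊕ T) ℤ, ∃ p₂₁ : Matrix T S ℤ, ∃ p₂₂ : Matrix T T ℤ,
      (p : Matrix (S ⊕ T) (S ⊕ T) ℤ) = fromBlocks (1 : Matrix S S ℤ) 0 p₂₁ p₂₂ ∧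
      ∃ ε : T → ℤ, (∀ i, ε i = 1 ∨ ε i = -1) ∧
        (((p⁻¹ : Matrix.SpecialLinearGroup (S ⊕ T) ℤ) : Matrix (S ⊕ T) (S ⊕ T) ℤ) *
            fromBlocks (1 : Matrix S S ℤ) 0 A₂₁ A₂₂ * p).map (Int.castRingHom (ZMod (2 ^ k))) =
          diagonal (Sum.elim (fun _ => (1 : ZMod (2 ^ k))) fun i => (ε i : ZMod (2 ^ k))) := by
  set A := fromBlocks (1 : Matrix S S ℤ) 0 A₂₁ A₂₂ with hA
  have hAt : Aᵀ = fromBlocks (1 : Matrix S S ℤ) A₂₁ᵀ 0 A₂₂ᵀ := by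
    rw [hA, fromBlocks_transpose, transpose_one, transpose_zero]
  have h1t : (fromBlocks (1 : Matrix S S ℤ) A₂₁ᵀ 0 A₂₂ᵀ).map (Int.castRingHom (ZMod 2)) = 1 := by
    rw [← hAt, Matrix.transpose_map, h1, transpose_one]
  have h2t : (fromBlocks (1 : Matrix S S ℤ) A₂₁ᵀ 0 A₂₂ᵀ * fromBlocks (1 : Matrix S S ℤ) A₂₁ᵀ 0 A₂₂ᵀ).map
      (Int.castRingHom (ZMod (2 ^ (k + 1)))) = 1 := by
    rw [← hAt, ← Matrix.transpose_mul, Matrix.transpose_map, h2, transpose_one]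
  obtain ⟨X, Y, ε, hε, hrel⟩ := exists_fromBlocks_mul_map_eq_mul_diagonal k A₂₁ᵀ A₂₂ᵀ h1t h2t
  rw [← hAt] at hrel
  -- transpose: `ᵗQ A ≡ D ᵗQ`
  set Q := fromBlocks (1 : Matrix S S ℤ) X 0 (Y : Matrix T T ℤ) with hQ
  set D : Matrix (S ⊕ T) (S ⊕ T) ℤ := diagonal (Sum.elim (fun (_ : S) => (1 : ℤ)) ε) with hD
  have hrelt : (Qᵀ * A).map (Int.castRingHom (ZMod (2 ^ k))) = (D * Qᵀ).map (Int.castRingHom (ZMod (2 ^ k))) := by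
    have h := congrArg Matrix.transpose hrel
    rwa [← Matrix.transpose_map, ← Matrix.transpose_map, Matrix.transpose_mul, Matrix.transpose_mul,
      transpose_transpose, hD, diagonal_transpose] at h
  -- the inverse `p = (ᵗQ)⁻¹ = (1 0; p₂₁ p₂₂)`
  let p₂₂ : Matrix T T ℤ := ((Y.transpose⁻¹ : Matrix.SpecialLinearGroup T ℤ) : Matrix T T ℤ)
  have hYp : (Y : Matrix T T ℤ)ᵀ * p₂₂ = 1 := by
    have h := congrArg (fun g : Matrix.SpecialLinearGroup T ℤ => (g : Matrix T T ℤ)) (mul_inv_cancel Y.transpose)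
    simpa only [Matrix.SpecialLinearGroup.coe_mul, Matrix.SpecialLinearGroup.coe_one,
      Matrix.SpecialLinearGroup.coe_transpose] using h
  let p₂₁ : Matrix T S ℤ := -(p₂₂ * Xᵀ)
  have hQt : Qᵀ = fromBlocks (1 : Matrix S S ℤ) 0 Xᵀ (Y : Matrix T T ℤ)ᵀ := by
    rw [hQ, fromBlocks_transpose, transpose_one, transpose_zero]
  have hQp : Qᵀ * fromBlocks (1 : Matrix S S ℤ) 0 p₂₁ p₂₂ = 1 := by
    rw [hQt, fromBlocks_multiply, ← fromBlocks_one]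
    simp only [Matrix.mul_one, Matrix.one_mul, Matrix.mul_zero, Matrix.zero_mul, add_zero, zero_add, p₂₁,
      Matrix.mul_neg, ← Matrix.mul_assoc, hYp, Matrix.one_mul, add_neg_cancel, neg_zero]
  have hdetQ : (Qᵀ).det = 1 := by rw [det_transpose, hQ, det_fromBlocks_one_zero, Y.2]
  have hdetp : (fromBlocks (1 : Matrix S S ℤ) 0 p₂₁ p₂₂).det = 1 := by
    rw [det_fromBlocks_zero₁₂, det_one, one_mul]
    exact (Y.transpose⁻¹).2
  let q : Matrix.SpecialLinearGroup (S ⊕ T) ℤ := ⟨Qᵀ, hdetQ⟩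
  let p : Matrix.SpecialLinearGroup (S ⊕ T) ℤ := ⟨fromBlocks (1 : Matrix S S ℤ) 0 p₂₁ p₂₂, hdetp⟩
  have hqp : q * p = 1 := Subtype.ext hQp
  have hpinv : p⁻¹ = q := inv_eq_of_mul_eq_one_left hqp
  refine ⟨p, p₂₁, p₂₂, rfl, ε, hε, ?_⟩
  rw [hpinv]
  change (Qᵀ * A * fromBlocks (1 : Matrix S S ℤ) 0 p₂₁ p₂₂).map _ = _
  rw [Matrix.map_mul, hrelt, ← Matrix.map_mul, Matrix.mul_assoc, hQp, Matrix.mul_one, hD, diagonal_map_intCast_zmod]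
  congr 1
  ext i
  cases i with
  | inl a => exact Int.cast_one
  | inr c => rfl

end Blocks

/-! ## §6. The «moreover» clause over an arbitrary index type: identity rows indexed by a finset `S` -/

section Finset

variable {n : Type*} [Fintype n] [DecidableEq n]

/-- **Goresky–Tai 2003, Lemma 26 with its «moreover» clause over any finite index type.**  If the rows of `A`
indexed by `i ∈ S` are the corresponding rows of the identity («the matrix of `A` … is `(I_q 0; * *)`», `S` = the
first `q` indices) and `A ≡ I (mod 2)`, `A² ≡ I (mod 2^{k+1})`, then there is `p ∈ SL_n(ℤ)` whose rows indexed by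
`S` are again identity rows («`p = (I_q 0; * *)`») with `p⁻¹Ap ≡ diag(ε) (mod 2^k)`, `ε ∈ {±1}ⁿ`, `ε = 1` on `S`.
Reduction to the block form `exists_specialLinearGroup_fromBlocks_conj_map_eq_diagonal` along
`Equiv.sumCompl : S ⊕ Sᶜ ≃ n`.  [cite: GoreskyTai2003RealModuli, §10.1 Lemma 26] -/
theorem exists_specialLinearGroup_conj_map_eq_diagonal_of_forall_mem_finset (k : ℕ) (S : Finset n)
    (A : Matrix n n ℤ) (hS : ∀ i ∈ S, ∀ j, A i j = (1 : Matrix n n ℤ) i j)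
    (h1 : A.map (Int.castRingHom (ZMod 2)) = 1)
    (h2 : (A * A).map (Int.castRingHom (ZMod (2 ^ (k + 1)))) = 1) :
    ∃ p : Matrix.SpecialLinearGroup n ℤ, (∀ i ∈ S, ∀ j, (p : Matrix n n ℤ) i j = (1 : Matrix n n ℤ) i j) ∧
      ∃ ε : n → ℤ, (∀ i, ε i = 1 ∨ ε i = -1) ∧ (∀ i ∈ S, ε i = 1) ∧
        (((p⁻¹ : Matrix.SpecialLinearGroup n ℤ) : Matrix n n ℤ) * A * p).map (Int.castRingHom (ZMod (2 ^ k))) =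
          diagonal fun i => (ε i : ZMod (2 ^ k)) := by
  classical
  set e : {i // i ∈ S} ⊕ {i // i ∉ S} ≃ n := Equiv.sumCompl fun i => i ∈ S with he
  set A' : Matrix ({i // i ∈ S} ⊕ {i // i ∉ S}) ({i // i ∈ S} ⊕ {i // i ∉ S}) ℤ := A.submatrix e e with hA'
  have hA'blocks : A' = fromBlocks (1 : Matrix {i // i ∈ S} {i // i ∈ S} ℤ) 0 A'.toBlocks₂₁ A'.toBlocks₂₂ := by
    conv_lhs => rw [← fromBlocks_toBlocks A']
    congr 1
    · ext a b
      simp only [toBlocks₁₁, of_apply, hA', submatrix_apply, he, Equiv.sumCompl_apply_inl]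
      rw [hS _ a.2, Matrix.one_apply, Matrix.one_apply]
      by_cases hab : a = b
      · rw [if_pos hab, if_pos (congrArg Subtype.val hab)]
      · rw [if_neg hab, if_neg (fun h => hab (Subtype.ext h))]
    · ext a c
      simp only [toBlocks₁₂, of_apply, hA', submatrix_apply, he, Equiv.sumCompl_apply_inl, Equiv.sumCompl_apply_inr]
      rw [hS _ a.2, Matrix.one_apply, Matrix.zero_apply, if_neg]
      intro h
      exact c.2 (h ▸ a.2)
  have h1' : A'.map (Int.castRingHom (ZMod 2)) = 1 := by
    rw [hA', ← submatrix_map, h1, submatrix_one_equiv]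
  have h2' : (A' * A').map (Int.castRingHom (ZMod (2 ^ (k + 1)))) = 1 := by
    rw [hA', submatrix_mul_equiv, ← submatrix_map, h2, submatrix_one_equiv]
  rw [hA'blocks] at h1' h2'
  obtain ⟨p', p₂₁, p₂₂, hp', ε', hε', hconj⟩ :=
    exists_specialLinearGroup_fromBlocks_conj_map_eq_diagonal k A'.toBlocks₂₁ A'.toBlocks₂₂ h1' h2'
  rw [← hA'blocks] at hconj
  -- transport back along `e`
  have hdet : ((p' : Matrix _ _ ℤ).submatrix e.symm e.symm).det = 1 := by rw [det_submatrix_equiv_self, p'.2]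
  have hdet' : (((p'⁻¹ : Matrix.SpecialLinearGroup _ ℤ) : Matrix _ _ ℤ).submatrix e.symm e.symm).det = 1 := by
    rw [det_submatrix_equiv_self, (p'⁻¹).2]
  let p : Matrix.SpecialLinearGroup n ℤ := ⟨(p' : Matrix _ _ ℤ).submatrix e.symm e.symm, hdet⟩
  let q : Matrix.SpecialLinearGroup n ℤ :=
    ⟨((p'⁻¹ : Matrix.SpecialLinearGroup _ ℤ) : Matrix _ _ ℤ).submatrix e.symm e.symm, hdet'⟩
  have hqp : q * p = 1 := by
    apply Subtype.ext
    change ((p'⁻¹ : Matrix.SpecialLinearGroup _ ℤ) : Matrix _ _ ℤ).submatrix e.symm e.symm *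
        (p' : Matrix _ _ ℤ).submatrix e.symm e.symm = 1
    rw [submatrix_mul_equiv, ← Matrix.SpecialLinearGroup.coe_mul, inv_mul_cancel,
      Matrix.SpecialLinearGroup.coe_one, submatrix_one_equiv]
  have hpinv : p⁻¹ = q := inv_eq_of_mul_eq_one_left hqp
  have hA : A = A'.submatrix e.symm e.symm := by
    rw [hA', submatrix_submatrix, Equiv.self_comp_symm, submatrix_id_id]
  refine ⟨p, fun i hi j => ?_, fun i => Sum.elim (fun _ => (1 : ℤ)) ε' (e.symm i), fun i => ?_,
    fun i hi => ?_, ?_⟩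
  · -- identity rows
    change (p' : Matrix _ _ ℤ) (e.symm i) (e.symm j) = (1 : Matrix n n ℤ) i j
    rw [hp', he, Equiv.sumCompl_symm_apply_of_pos hi]
    by_cases hj : j ∈ S
    · rw [Equiv.sumCompl_symm_apply_of_pos hj, fromBlocks_apply₁₁, Matrix.one_apply, Matrix.one_apply]
      by_cases hij : i = j
      · subst hij
        rw [if_pos rfl, if_pos rfl]
      · rw [if_neg hij, if_neg (fun h => hij (congrArg Subtype.val h))]
    · rw [Equiv.sumCompl_symm_apply_of_neg hj, fromBlocks_apply₁₂, Matrix.zero_apply, Matrix.one_apply,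
        if_neg]
      intro h
      exact hj (h ▸ hi)
  · dsimp only
    cases e.symm i with
    | inl a => exact Or.inl rfl
    | inr c => exact hε' c
  · dsimp only
    rw [he, Equiv.sumCompl_symm_apply_of_pos hi, Sum.elim_inl]
  · rw [hpinv]
    change (((p'⁻¹ : Matrix.SpecialLinearGroup _ ℤ) : Matrix _ _ ℤ).submatrix e.symm e.symm * A *
        (p' : Matrix _ _ ℤ).submatrix e.symm e.symm).map _ = _
    rw [hA, submatrix_mul_equiv, submatrix_mul_equiv, ← submatrix_map, hconj, submatrix_diagonal_equiv]
    congr 1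
    funext i
    simp only [Function.comp_apply]
    cases e.symm i with
    | inl a => simp
    | inr c => simp

end Finset

/-! ## §7. The printed module form: a basis of approximate eigenvectors of `α` -/

section Module

variable {M : Type*} [AddCommGroup M] [Module ℤ M]

/-- Coordinates: `x ∈ N·M` iff `N` divides every coordinate of `x` in a basis.  [folklore] -/
private theorem exists_eq_smul_iff_forall_dvd_repr {ι : Type*} (b : Module.Basis ι ℤ M) (N : ℤ) (x : M) :
    (∃ m : M, x = N • m) ↔ ∀ i, N ∣ b.repr x i := by
  constructor
  · rintro ⟨m, rfl⟩ i
    exact ⟨b.repr m i, by rw [map_zsmul, Finsupp.smul_apply, smul_eq_mul]⟩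
  · intro h
    refine ⟨b.repr.symm ((b.repr x).mapRange (· / N) (by simp)), ?_⟩
    rw [← map_zsmul]
    apply b.repr.injective
    rw [LinearEquiv.apply_symm_apply]
    ext i
    rw [Finsupp.smul_apply, Finsupp.mapRange_apply, smul_eq_mul, Int.mul_ediv_cancel' (h i)]

/-- **Goresky–Tai 2003, Lemma 26 in its printed module form.**  «The lemma is equivalent to the following
statement.  Suppose `M` is a free `ℤ`-module of rank `n`.  Let `α : M → M` be an automorphism such that
`(α − I)M ⊂ 2M` and `(α² − I)M ⊂ 2^{k+1}M` […] Then there exists a basis `x_1, x_2, …, x_n` of `M` so that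
`α(x_i) = ±x_i ∈ 2^k M` for `i = 1, 2, …, n`» (read: `α(x_i) ∓ x_i ∈ 2^k M`).  Here for any endomorphism `α` of a
finitely generated free `ℤ`-module (bijectivity is not used); derived from the matrix form
`exists_specialLinearGroup_mul_map_eq_mul_diagonal` in the coordinates of a chosen basis, the new basis being
the columns of `P`.  [cite: GoreskyTai2003RealModuli, §10.4 (proof of Lemma 26)] -/
theorem exists_basis_forall_exists_apply_sub_smul_eq_pow_smul [Module.Free ℤ M] [Module.Finite ℤ M] (k : ℕ)
    (α : M →ₗ[ℤ] M) (h1 : ∀ m : M, ∃ m' : M, α m - m = (2 : ℤ) • m')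
    (h2 : ∀ m : M, ∃ m' : M, α (α m) - m = (2 ^ (k + 1) : ℤ) • m') :
    ∃ b : Module.Basis (Module.Free.ChooseBasisIndex ℤ M) ℤ M, ∃ ε : Module.Free.ChooseBasisIndex ℤ M → ℤ,
      (∀ i, ε i = 1 ∨ ε i = -1) ∧ ∀ i, ∃ m' : M, α (b i) - ε i • b i = (2 ^ k : ℤ) • m' := by
  classical
  let b₀ := Module.Free.chooseBasis ℤ M
  -- the hypotheses in coordinates: `f ≡ 1 (mod N)` on `M` means `[f] ≡ I (mod N)`
  have hcoord : ∀ (N : ℕ) (f : M →ₗ[ℤ] M), (∀ m : M, ∃ m' : M, f m - m = (N : ℤ) • m') →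
      (LinearMap.toMatrix b₀ b₀ f).map (Int.castRingHom (ZMod N)) = 1 := by
    intro N f hf
    have h0 : (LinearMap.toMatrix b₀ b₀ f - 1).map (Int.castRingHom (ZMod N)) = 0 := by
      rw [map_intCast_zmod_eq_zero_iff_forall_dvd]
      intro i j
      obtain ⟨m', hm'⟩ := hf (b₀ j)
      have h := (exists_eq_smul_iff_forall_dvd_repr b₀ (N : ℤ) (f (b₀ j) - b₀ j)).1 ⟨m', hm'⟩ i
      rw [map_sub, Finsupp.sub_apply, Module.Basis.repr_self] at h
      rw [Matrix.sub_apply, LinearMap.toMatrix_apply, Matrix.one_apply]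
      by_cases hij : i = j
      · subst hij
        simpa only [Finsupp.single_eq_same, if_true] using h
      · have hji : j ≠ i := fun h' => hij h'.symm
        rw [Finsupp.single_apply, if_neg hji] at h
        rwa [if_neg hij]
    rwa [Matrix.map_sub _ (map_sub (Int.castRingHom (ZMod N))), sub_eq_zero,
      Matrix.map_one _ (map_zero _) (map_one _)] at h0
  set A := LinearMap.toMatrix b₀ b₀ α with hA
  have h1A : A.map (Int.castRingHom (ZMod 2)) = 1 := hcoord 2 α (by simpa using h1)
  have h2A : (A * A).map (Int.castRingHom (ZMod (2 ^ (k + 1)))) = 1 := by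
    rw [hA, ← LinearMap.toMatrix_mul]
    exact hcoord (2 ^ (k + 1)) (α * α) (by simpa using h2)
  obtain ⟨P, ε, hε, hP⟩ := exists_specialLinearGroup_mul_map_eq_mul_diagonal k A h1A h2A
  rw [map_intCast_zmod_eq_map_iff_forall_modEq] at hP
  -- the new basis: the columns of `P`
  have hPP : Matrix.toLin b₀ b₀ (P : Matrix _ _ ℤ) ∘ₗ
      Matrix.toLin b₀ b₀ ((P⁻¹ : Matrix.SpecialLinearGroup _ ℤ) : Matrix _ _ ℤ) = LinearMap.id := by
    rw [← Matrix.toLin_mul, ← Matrix.SpecialLinearGroup.coe_mul, mul_inv_cancel, Matrix.SpecialLinearGroup.coe_one,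
      Matrix.toLin_one]
  have hPP' : Matrix.toLin b₀ b₀ ((P⁻¹ : Matrix.SpecialLinearGroup _ ℤ) : Matrix _ _ ℤ) ∘ₗ
      Matrix.toLin b₀ b₀ (P : Matrix _ _ ℤ) = LinearMap.id := by
    rw [← Matrix.toLin_mul, ← Matrix.SpecialLinearGroup.coe_mul, inv_mul_cancel, Matrix.SpecialLinearGroup.coe_one,
      Matrix.toLin_one]
  let eP : M ≃ₗ[ℤ] M := LinearEquiv.ofLinear _ _ hPP hPP'
  let b := b₀.map eP
  have hb : ∀ j, b j = Matrix.toLin b₀ b₀ (P : Matrix _ _ ℤ) (b₀ j) := fun j => by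
    simp only [b, Module.Basis.map_apply]
    rfl
  have hrepr_b : ∀ j i, b₀.repr (b j) i = (P : Matrix _ _ ℤ) i j := by
    intro j i
    have h := LinearMap.toMatrix_mulVec_repr b₀ b₀ (Matrix.toLin b₀ b₀ (P : Matrix _ _ ℤ)) (b₀ j)
    rw [LinearMap.toMatrix_toLin, Module.Basis.repr_self, Finsupp.single_eq_pi_single] at h
    rw [hb, ← congrFun h i, Matrix.mulVec, dotProduct]
    simp only [Pi.single_apply, mul_ite, mul_one, mul_zero, Finset.sum_ite_eq', Finset.mem_univ, if_true]
  have hrepr_αb : ∀ j i, b₀.repr (α (b j)) i =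
      (A * (P : Matrix (Module.Free.ChooseBasisIndex ℤ M) (Module.Free.ChooseBasisIndex ℤ M) ℤ)) i j := by
    intro j i
    have h := LinearMap.toMatrix_mulVec_repr b₀ b₀ α (b j)
    rw [← congrFun h i, Matrix.mulVec, dotProduct, Matrix.mul_apply]
    exact Finset.sum_congr rfl fun l _ => by rw [hrepr_b]
  refine ⟨b, ε, hε, fun j => (exists_eq_smul_iff_forall_dvd_repr b₀ _ _).2 fun i => ?_⟩
  rw [map_sub, map_zsmul, Finsupp.sub_apply, Finsupp.smul_apply, smul_eq_mul, hrepr_αb, hrepr_b]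
  have h := (hP i j).symm.dvd
  rw [mul_diagonal, Nat.cast_pow, Nat.cast_ofNat] at h
  rwa [mul_comm (ε j)]

end Module

end Literature.LinearAlgebra.Matrix
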